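import Literature.Analysis.Complex.PickFunctionsProofs
import HarnessLib

/-!
# Loewner's theorem, Part I — step 1: operator monotone functions on `(0, ∞)` are operator
# concave and continuous (Hansen 2013, Theorem 2.1)

First brick of the hard direction (`→`) of the named fact
`Literature.Analysis.Complex.loewner_theorem` along F. Hansen's "fast track"
(*The fast track to Löwner's theorem*, Linear Algebra Appl. 438 (2013) 4557–4571,
[Hansen2013]), Section 2:

* a small toolkit transporting the matrix functional calculus along polynomial identities
  (`cfc_eq_aeval_of_eqOn`: on a Hermitian matrix `cfc f = aeval p` for any polynomial `p`
  agreeing with `f` on the finite spectrum; hence `cfc_fromBlocks_diag`, `cfc_unitary_conj`,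
  `cfc_reindex`, `cfc_smul_one`);
* Hansen's unitary dilation `V = [[a, -b], [b, a]] ⊗ 1` and the Schur-complement step
  (`rotation_conj_fromBlocks`, `rotation_mem_unitaryGroup`,
  `exists_posSemidef_fromBlocks_smul_one`);
* `smul_cfc_add_smul_cfc_le_cfc_add` — **Theorem 2.1, inequality (1)**: if `f` is `2n`-monotone on
  `(0, ∞)` then `s f(A) + (1 - s) f(B) ≤ f(sA + (1 - s)B + ε)` for positive definite `A, B` of
  order `n`, `0 ≤ s ≤ 1`, `ε > 0`;
* `continuousOn_of_isMatrixMonotoneOn_Ioi`, `concaveOn_of_isMatrixMonotoneOn_Ioi` — a matrix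
  monotone function (all orders; `2`-monotone suffices in print) on `(0, ∞)` is continuous and
  concave (Theorem 2.1 with `n = 1`; the continuity argument is arranged as an iteration
  `η ↦ η/6` of inequality (1) instead of Hansen's right-limit function `f⁺`);
* `smul_cfc_add_smul_cfc_le_cfc` — **Corollary 2.2**: operator monotone on `(0, ∞)` ⇒ operator
  concave (`ε → 0` by continuity of `f` on the finite spectrum, through the spectral quadratic
  forms of `Literature.Analysis.Complex.star_dotProduct_cfc_mulVec`).

Matrix monotonicity is `Literature.Analysis.Complex.IsMatrixMonotoneOn` (all orders `Fin m`);
order-`2n` hypotheses are phrased on `Fin n ⊕ Fin n`-indexed matrices and obtained from it by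
reindexing (`matrixMonotone_sum_of_isMatrixMonotoneOn`). No new definitions.
-/

noncomputable section

open scoped ComplexOrder ComplexConjugate MatrixOrder Matrix.Norms.L2Operator
open Complex Set Filter Topology Metric Real Matrix Polynomial

namespace Literature.Analysis.Complex

section CfcTransport

variable {m : Type*} [Fintype m] [DecidableEq m]

/-- On a finite set of reals every real function agrees with a polynomial. [folklore] -/
theorem exists_polynomial_eqOn_finite {T : Set ℝ} (hT : T.Finite) (f : ℝ → ℝ) :
    ∃ p : ℝ[X], ∀ x ∈ T, p.eval x = f x := by
  refine ⟨Lagrange.interpolate hT.toFinset id f, fun x hx => ?_⟩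
  have hx' : x ∈ hT.toFinset := hT.mem_toFinset.2 hx
  simpa using Lagrange.eval_interpolate_at_node (v := id) (r := f) (Set.injOn_id _) hx'

/-- The functional calculus of a Hermitian matrix is a polynomial calculus: if `p = f` on a set
containing the spectrum then `cfc f M = aeval M p`. [folklore] -/
theorem cfc_eq_aeval_of_eqOn {M : Matrix m m ℂ} (hM : M.IsHermitian) {f : ℝ → ℝ} {p : ℝ[X]}
    (hp : ∀ x ∈ spectrum ℝ M, p.eval x = f x) : cfc f M = aeval M p := by
  have hM' : IsSelfAdjoint M := hM
  rw [← cfc_polynomial p M hM']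
  exact cfc_congr fun x hx => (hp x hx).symm

/-- `aeval` of a block-diagonal matrix is block-diagonal. [folklore] -/
theorem aeval_fromBlocks_diag {k : Type*} [Fintype k] [DecidableEq k] (A B : Matrix k k ℂ)
    (p : ℝ[X]) : aeval (fromBlocks A 0 0 B) p = fromBlocks (aeval A p) 0 0 (aeval B p) := by
  induction p using Polynomial.induction_on' with
  | add p q hp hq => rw [map_add, map_add, map_add, hp, hq, fromBlocks_add, add_zero]
  | monomial j c =>
    rw [aeval_monomial, aeval_monomial, aeval_monomial]
    have hpow : ∀ i : ℕ, (fromBlocks A 0 0 B) ^ i = fromBlocks (A ^ i) 0 0 (B ^ i) := by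
      intro i
      induction i with
      | zero => simp [fromBlocks_one]
      | succ i ih =>
        rw [pow_succ, ih, fromBlocks_multiply, pow_succ, pow_succ]
        simp
    rw [hpow]
    simp only [Algebra.algebraMap_eq_smul_one, smul_mul_assoc, one_mul, fromBlocks_smul,
      smul_zero]

/-- **The functional calculus of a block-diagonal Hermitian matrix is block-diagonal.**
[folklore] -/
theorem cfc_fromBlocks_diag {k : Type*} [Fintype k] [DecidableEq k] {A B : Matrix k k ℂ}
    (hA : A.IsHermitian) (hB : B.IsHermitian) (f : ℝ → ℝ) :
    cfc f (fromBlocks A 0 0 B) = fromBlocks (cfc f A) 0 0 (cfc f B) := by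
  have hAB : (fromBlocks A 0 0 B).IsHermitian :=
    IsHermitian.fromBlocks hA (by simp) hB
  obtain ⟨p, hp⟩ := exists_polynomial_eqOn_finite
    ((Matrix.finite_real_spectrum (A := A)).union ((Matrix.finite_real_spectrum (A := B)).union
      (Matrix.finite_real_spectrum (A := fromBlocks A 0 0 B)))) f
  rw [cfc_eq_aeval_of_eqOn hAB fun x hx => hp x (Or.inr (Or.inr hx)),
    cfc_eq_aeval_of_eqOn hA fun x hx => hp x (Or.inl hx),
    cfc_eq_aeval_of_eqOn hB fun x hx => hp x (Or.inr (Or.inl hx)), aeval_fromBlocks_diag]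

/-- **The functional calculus commutes with unitary conjugation.** [folklore] -/
theorem cfc_unitary_conj {M U : Matrix m m ℂ} (hM : M.IsHermitian)
    (hU : U ∈ Matrix.unitaryGroup m ℂ) (f : ℝ → ℝ) :
    cfc f (U * M * star U) = U * cfc f M * star U := by
  set u : unitary (Matrix m m ℂ) := ⟨U, hU⟩ with hu
  have hφ : ∀ X : Matrix m m ℂ, Unitary.conjStarAlgAut ℝ (Matrix m m ℂ) u X = U * X * star U :=
    fun X => rfl
  have hM' : (U * M * star U).IsHermitian := by
    have hU' : star U * U = 1 := Matrix.mem_unitaryGroup_iff'.mp hU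
    unfold Matrix.IsHermitian
    rw [star_eq_conjTranspose, conjTranspose_mul, conjTranspose_mul, conjTranspose_conjTranspose,
      hM.eq, Matrix.mul_assoc]
  obtain ⟨p, hp⟩ := exists_polynomial_eqOn_finite
    ((Matrix.finite_real_spectrum (A := M)).union
      (Matrix.finite_real_spectrum (A := U * M * star U))) f
  rw [cfc_eq_aeval_of_eqOn hM' fun x hx => hp x (Or.inr hx),
    cfc_eq_aeval_of_eqOn hM fun x hx => hp x (Or.inl hx), ← hφ, ← hφ,
    Polynomial.aeval_algHom_apply]

/-- **The functional calculus commutes with reindexing.** [folklore] -/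
theorem cfc_reindex {k : Type*} [Fintype k] [DecidableEq k] (e : m ≃ k) {M : Matrix m m ℂ}
    (hM : M.IsHermitian) (f : ℝ → ℝ) :
    cfc f (reindex e e M) = reindex e e (cfc f M) := by
  have hM' : (reindex e e M).IsHermitian := by
    unfold Matrix.IsHermitian
    rw [reindex_apply, conjTranspose_submatrix, hM.eq]
  obtain ⟨p, hp⟩ := exists_polynomial_eqOn_finite
    ((Matrix.finite_real_spectrum (A := M)).union
      (Matrix.finite_real_spectrum (A := reindex e e M))) f
  have hφ : ∀ X : Matrix m m ℂ, Matrix.reindexAlgEquiv ℝ ℂ e X = reindex e e X := fun X => rfl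
  rw [cfc_eq_aeval_of_eqOn hM' fun x hx => hp x (Or.inr hx),
    cfc_eq_aeval_of_eqOn hM fun x hx => hp x (Or.inl hx), ← hφ, ← hφ,
    Polynomial.aeval_algHom_apply]

/-- The functional calculus of a scalar matrix. [folklore] -/
theorem cfc_smul_one (x : ℝ) (f : ℝ → ℝ) :
    cfc f ((x : ℂ) • (1 : Matrix m m ℂ)) = (f x : ℂ) • (1 : Matrix m m ℂ) := by
  have h1 : ((x : ℂ) • (1 : Matrix m m ℂ)) = algebraMap ℝ (Matrix m m ℂ) x := by
    rw [Algebra.algebraMap_eq_smul_one]; rfl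
  have h2 : ((f x : ℂ) • (1 : Matrix m m ℂ)) = algebraMap ℝ (Matrix m m ℂ) (f x) := by
    rw [Algebra.algebraMap_eq_smul_one]; rfl
  rw [h1, h2, cfc_algebraMap]

end CfcTransport

/-! ### Hansen's unitary dilation (Hansen 2013, proof of Theorem 2.1) -/

section Dilation

variable {n : ℕ}

/-- Conjugating a block-diagonal matrix by the rotation `V = [[a, -b], [b, a]] ⊗ 1`:
`Vᴴ (P ⊕ Q) V = [[a²P + b²Q, ab(Q - P)], [ab(Q - P), b²P + a²Q]]`. [cite: Hansen2013, proof of Theorem 2.1] -/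
theorem rotation_conj_fromBlocks (a b : ℝ) (P Q : Matrix (Fin n) (Fin n) ℂ) :
    star (fromBlocks ((a : ℂ) • (1 : Matrix (Fin n) (Fin n) ℂ)) (-((b : ℂ) • 1)) ((b : ℂ) • 1)
        ((a : ℂ) • 1)) * fromBlocks P 0 0 Q *
      fromBlocks ((a : ℂ) • (1 : Matrix (Fin n) (Fin n) ℂ)) (-((b : ℂ) • 1)) ((b : ℂ) • 1)
        ((a : ℂ) • 1) =
    fromBlocks (((a ^ 2 : ℝ) : ℂ) • P + ((b ^ 2 : ℝ) : ℂ) • Q) (((a * b : ℝ) : ℂ) • (Q - P))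
      (((a * b : ℝ) : ℂ) • (Q - P)) (((b ^ 2 : ℝ) : ℂ) • P + ((a ^ 2 : ℝ) : ℂ) • Q) := by
  rw [star_eq_conjTranspose, fromBlocks_conjTranspose]
  simp only [conjTranspose_smul, conjTranspose_one, conjTranspose_neg, Complex.star_def,
    Complex.conj_ofReal, fromBlocks_multiply]
  simp only [smul_mul_assoc, one_mul, Matrix.mul_smul, Matrix.mul_one, neg_mul, mul_neg,
    smul_zero, neg_zero, add_zero, zero_add, smul_smul, neg_neg]
  push_cast
  congr 1 <;> module

/-- The rotation `V` is unitary when `a² + b² = 1`. [cite: Hansen2013, proof of Theorem 2.1] -/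
theorem rotation_mem_unitaryGroup {a b : ℝ} (hab : a ^ 2 + b ^ 2 = 1) :
    fromBlocks ((a : ℂ) • (1 : Matrix (Fin n) (Fin n) ℂ)) (-((b : ℂ) • 1)) ((b : ℂ) • 1)
        ((a : ℂ) • 1) ∈ Matrix.unitaryGroup (Fin n ⊕ Fin n) ℂ := by
  rw [Matrix.mem_unitaryGroup_iff']
  have h := rotation_conj_fromBlocks (n := n) a b 1 1
  rw [fromBlocks_one, Matrix.mul_one] at h
  rw [h, sub_self, smul_zero, ← add_smul, ← add_smul, ← ofReal_add, ← ofReal_add, hab, add_comm,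
    hab]
  simp [fromBlocks_one]

end Dilation

section HansenConcavity

variable {n : ℕ}

/-- The Schur-complement step: `[[ε1, N], [N, μ1 - E]] ≥ 0` for `μ` large (`ε > 0`, `N`, `E`
Hermitian). [cite: Hansen2013, proof of Theorem 2.1] -/
theorem exists_posSemidef_fromBlocks_smul_one {ε : ℝ} (hε : 0 < ε) {N E : Matrix (Fin n) (Fin n) ℂ}
    (hN : N.IsHermitian) (hE : E.IsHermitian) :
    ∃ μ₀ : ℝ, ∀ μ : ℝ, μ₀ ≤ μ →
      (fromBlocks ((ε : ℂ) • (1 : Matrix (Fin n) (Fin n) ℂ)) N N ((μ : ℂ) • 1 - E)).PosSemidef := by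
  letI : CStarAlgebra (Matrix (Fin n) (Fin n) ℂ) := {}
  set H : Matrix (Fin n) (Fin n) ℂ := E + (ε⁻¹ : ℂ) • (N * N) with hH
  have hHsa : IsSelfAdjoint H := by
    have h1 : IsSelfAdjoint E := hE
    have h2 : IsSelfAdjoint (N * N) := by
      have : (N * N).IsHermitian := by
        unfold Matrix.IsHermitian; rw [conjTranspose_mul, hN.eq]
      exact this
    have h3 : IsSelfAdjoint ((ε⁻¹ : ℂ) • (N * N)) := by
      have : ((ε⁻¹ : ℂ) • (N * N)).IsHermitian := by
        unfold Matrix.IsHermitian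
        rw [conjTranspose_smul, (show (N * N).IsHermitian from h2).eq]
        simp
      exact this
    exact h1.add h3
  refine ⟨‖H‖, fun μ hμ => ?_⟩
  have hεunit : IsUnit ((ε : ℂ) • (1 : Matrix (Fin n) (Fin n) ℂ)) := by
    rw [← Algebra.algebraMap_eq_smul_one]
    exact (isUnit_iff_ne_zero.2 (ofReal_ne_zero.2 hε.ne')).map _
  letI : Invertible ((ε : ℂ) • (1 : Matrix (Fin n) (Fin n) ℂ)) := hεunit.invertible
  have hεpd : ((ε : ℂ) • (1 : Matrix (Fin n) (Fin n) ℂ)).PosDef := by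
    rw [← Algebra.algebraMap_eq_smul_one]
    have : ((ε : ℂ) • (1 : Matrix (Fin n) (Fin n) ℂ)) = (ε : ℝ) • (1 : Matrix (Fin n) (Fin n) ℂ) := rfl
    rw [Algebra.algebraMap_eq_smul_one, this]
    exact PosDef.one.smul hε
  have hkey := Matrix.PosDef.fromBlocks₁₁ N ((μ : ℂ) • 1 - E) hεpd
  rw [hN.eq] at hkey
  rw [hkey]
  -- `(μ1 - E) - N (ε1)⁻¹ N = μ1 - H ≥ 0`
  have hinv : ((ε : ℂ) • (1 : Matrix (Fin n) (Fin n) ℂ))⁻¹ = (ε⁻¹ : ℂ) • 1 := by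
    apply Matrix.inv_eq_left_inv
    rw [smul_mul_smul_comm, one_mul, inv_mul_cancel₀ (ofReal_ne_zero.2 hε.ne'), one_smul]
  have hsub : (μ : ℂ) • 1 - E - N * ((ε : ℂ) • (1 : Matrix (Fin n) (Fin n) ℂ))⁻¹ * N =
      (μ : ℂ) • 1 - H := by
    rw [hinv, hH, Matrix.mul_smul, Matrix.mul_one, smul_mul_assoc]
    abel
  rw [hsub, ← Matrix.nonneg_iff_posSemidef, sub_nonneg]
  have h1 : H ≤ algebraMap ℝ (Matrix (Fin n) (Fin n) ℂ) ‖H‖ := hHsa.le_algebraMap_norm_self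
  have h2 : algebraMap ℝ (Matrix (Fin n) (Fin n) ℂ) ‖H‖ ≤ (μ : ℂ) • 1 := by
    have : ((μ : ℂ) • (1 : Matrix (Fin n) (Fin n) ℂ)) = algebraMap ℝ (Matrix (Fin n) (Fin n) ℂ) μ := by
      rw [Algebra.algebraMap_eq_smul_one]; rfl
    rw [this]
    exact algebraMap_mono _ hμ
  exact h1.trans h2

end HansenConcavity

section HansenConcavity2

variable {n : ℕ}

/-- Difference of block matrices. [folklore] -/
theorem fromBlocks_sub' {k : Type*} (a b c d a' b' c' d' : Matrix k k ℂ) :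
    fromBlocks a b c d - fromBlocks a' b' c' d' =
      fromBlocks (a - a') (b - b') (c - c') (d - d') := by
  rw [sub_eq_add_neg, fromBlocks_neg, fromBlocks_add]
  simp only [sub_eq_add_neg]

/-- The real spectrum of a block-diagonal matrix lies in the union of the spectra of its blocks.
[folklore] -/
theorem spectrum_fromBlocks_diag_subset {k : Type*} [Fintype k] [DecidableEq k]
    (A B : Matrix k k ℂ) :
    spectrum ℝ (fromBlocks A 0 0 B) ⊆ spectrum ℝ A ∪ spectrum ℝ B := by
  intro r hr
  by_contra h
  simp only [mem_union, not_or] at h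
  obtain ⟨hA, hB⟩ := h
  rw [spectrum.mem_iff, not_not] at hA hB
  apply hr
  have : algebraMap ℝ (Matrix (k ⊕ k) (k ⊕ k) ℂ) r - fromBlocks A 0 0 B =
      fromBlocks (algebraMap ℝ (Matrix k k ℂ) r - A) 0 0 (algebraMap ℝ (Matrix k k ℂ) r - B) := by
    rw [Algebra.algebraMap_eq_smul_one, Algebra.algebraMap_eq_smul_one, ← fromBlocks_one,
      fromBlocks_smul, smul_zero, fromBlocks_sub', sub_zero]
  rw [spectrum.mem_resolventSet_iff, this, isUnit_fromBlocks_zero₂₁]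
  exact ⟨hA, hB⟩

/-- The real spectrum of a scalar matrix. [folklore] -/
theorem spectrum_smul_one_subset {k : Type*} [Fintype k] [DecidableEq k] (c : ℝ) :
    spectrum ℝ ((c : ℂ) • (1 : Matrix k k ℂ)) ⊆ {c} := by
  intro r hr
  by_contra h
  apply hr
  have : algebraMap ℝ (Matrix k k ℂ) r - (c : ℂ) • 1 = ((r - c : ℝ) : ℂ) • (1 : Matrix k k ℂ) := by
    rw [Algebra.algebraMap_eq_smul_one, ofReal_sub, sub_smul]; rfl
  rw [spectrum.mem_resolventSet_iff, this, ← Algebra.algebraMap_eq_smul_one]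
  exact (isUnit_iff_ne_zero.2 (ofReal_ne_zero.2 (sub_ne_zero.2 h))).map _

/-- A positive definite matrix has real spectrum in `(0, ∞)`. [folklore] -/
theorem spectrum_subset_Ioi_of_posDef {k : Type*} [Fintype k] [DecidableEq k] {M : Matrix k k ℂ}
    (hM : M.PosDef) : spectrum ℝ M ⊆ Ioi 0 := by
  rw [hM.1.spectrum_real_eq_range_eigenvalues]
  rintro _ ⟨i, rfl⟩
  exact hM.eigenvalues_pos i

/-- A Hermitian matrix with real spectrum in `(0, ∞)` is positive definite. [folklore] -/
theorem posDef_of_spectrum_subset_Ioi {k : Type*} [Fintype k] [DecidableEq k] {M : Matrix k k ℂ}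
    (hM : M.IsHermitian) (hsp : spectrum ℝ M ⊆ Ioi 0) : M.PosDef := by
  rw [hM.posDef_iff_eigenvalues_pos]
  intro i
  exact hsp (hM.eigenvalues_mem_spectrum_real i)

/-- **Hansen's concavity inequality, ε-form** (Hansen 2013, proof of Theorem 2.1, inequality (1)):
if `f` is `2n`-monotone on `(0, ∞)` then for positive definite `n × n` matrices `A`, `B`,
`0 ≤ s ≤ 1` and `ε > 0`, `s f(A) + (1 - s) f(B) ≤ f(sA + (1 - s)B + ε)`.
[cite: Hansen2013, Theorem 2.1] -/
theorem smul_cfc_add_smul_cfc_le_cfc_add {f : ℝ → ℝ}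
    (hf : ∀ X Y : Matrix (Fin n ⊕ Fin n) (Fin n ⊕ Fin n) ℂ, X.IsHermitian → Y.IsHermitian →
      spectrum ℝ X ⊆ Ioi 0 → spectrum ℝ Y ⊆ Ioi 0 → (Y - X).PosSemidef →
        (cfc f Y - cfc f X).PosSemidef)
    {A B : Matrix (Fin n) (Fin n) ℂ} (hA : A.PosDef) (hB : B.PosDef) {s : ℝ} (hs0 : 0 ≤ s)
    (hs1 : s ≤ 1) {ε : ℝ} (hε : 0 < ε) :
    (cfc f ((s : ℂ) • A + ((1 - s : ℝ) : ℂ) • B + (ε : ℂ) • 1) -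
      ((s : ℂ) • cfc f A + ((1 - s : ℝ) : ℂ) • cfc f B)).PosSemidef := by
  -- the rotation
  set a : ℝ := Real.sqrt s with ha
  set b : ℝ := Real.sqrt (1 - s) with hb
  have ha2 : a ^ 2 = s := by rw [ha, sq_sqrt hs0]
  have hb2 : b ^ 2 = 1 - s := by rw [hb, sq_sqrt (by linarith)]
  have hab : a ^ 2 + b ^ 2 = 1 := by rw [ha2, hb2]; ring
  set c : ℝ := a * b with hc
  set V : Matrix (Fin n ⊕ Fin n) (Fin n ⊕ Fin n) ℂ :=
    fromBlocks ((a : ℂ) • (1 : Matrix (Fin n) (Fin n) ℂ)) (-((b : ℂ) • 1)) ((b : ℂ) • 1)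
      ((a : ℂ) • 1) with hV
  have hVu : V ∈ Matrix.unitaryGroup (Fin n ⊕ Fin n) ℂ := rotation_mem_unitaryGroup hab
  have hconj : ∀ P Q : Matrix (Fin n) (Fin n) ℂ, star V * fromBlocks P 0 0 Q * V =
      fromBlocks ((s : ℂ) • P + ((1 - s : ℝ) : ℂ) • Q) ((c : ℂ) • (Q - P)) ((c : ℂ) • (Q - P))
        (((1 - s : ℝ) : ℂ) • P + (s : ℂ) • Q) := by
    intro P Q
    rw [hV, rotation_conj_fromBlocks, ha2, hb2]
  -- the matrices `X' = V⋆ (A ⊕ B) V ≤ Y`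
  have hAh : A.IsHermitian := hA.1
  have hBh : B.IsHermitian := hB.1
  have hNh : ((c : ℂ) • (B - A)).IsHermitian := by
    unfold Matrix.IsHermitian
    rw [conjTranspose_smul, (hBh.sub hAh).eq]
    simp
  have hEh : (((1 - s : ℝ) : ℂ) • A + (s : ℂ) • B).IsHermitian := by
    unfold Matrix.IsHermitian
    rw [conjTranspose_add, conjTranspose_smul, conjTranspose_smul, hAh.eq, hBh.eq]
    simp
  obtain ⟨μ₀, hμ₀⟩ := exists_posSemidef_fromBlocks_smul_one (n := n) hε hNh.neg hEh
  set μ : ℝ := max μ₀ 1 with hμ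
  have hμpos : 0 < μ := lt_of_lt_of_le one_pos (le_max_right _ _)
  set C : Matrix (Fin n) (Fin n) ℂ := (s : ℂ) • A + ((1 - s : ℝ) : ℂ) • B with hC
  set X' : Matrix (Fin n ⊕ Fin n) (Fin n ⊕ Fin n) ℂ := star V * fromBlocks A 0 0 B * V with hX'
  set Y : Matrix (Fin n ⊕ Fin n) (Fin n ⊕ Fin n) ℂ :=
    fromBlocks (C + (ε : ℂ) • 1) 0 0 ((μ : ℂ) • 1) with hY
  have hX'eq : X' = fromBlocks C ((c : ℂ) • (B - A)) ((c : ℂ) • (B - A))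
      (((1 - s : ℝ) : ℂ) • A + (s : ℂ) • B) := hconj A B
  -- positivity of `C`
  have hCpsd : C.PosSemidef := by
    rw [hC]
    have h1 : ((s : ℂ) • A).PosSemidef := by
      have : ((s : ℂ) • A) = s • A := rfl
      rw [this]; exact hA.posSemidef.smul hs0
    have h2 : (((1 - s : ℝ) : ℂ) • B).PosSemidef := by
      have : (((1 - s : ℝ) : ℂ) • B) = (1 - s) • B := rfl
      rw [this]; exact hB.posSemidef.smul (by linarith)
    exact h1.add h2
  have hCε : (C + (ε : ℂ) • 1).PosDef := by
    have : ((ε : ℂ) • (1 : Matrix (Fin n) (Fin n) ℂ)) = ε • (1 : Matrix (Fin n) (Fin n) ℂ) := rfl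
    rw [this]
    exact PosDef.posSemidef_add hCpsd (PosDef.one.smul hε)
  -- Hermitian-ness and spectra
  have hXh : (fromBlocks A 0 0 B : Matrix (Fin n ⊕ Fin n) (Fin n ⊕ Fin n) ℂ).IsHermitian :=
    IsHermitian.fromBlocks hAh (by simp) hBh
  have hX'h : X'.IsHermitian := by
    rw [hX'eq]
    exact IsHermitian.fromBlocks (hEh.sub hEh |>.add hCpsd.1 |> fun _ => hCpsd.1) hNh.eq hEh
  have hYh : Y.IsHermitian := by
    rw [hY]
    refine IsHermitian.fromBlocks hCε.1 (by simp) ?_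
    unfold Matrix.IsHermitian
    rw [conjTranspose_smul, conjTranspose_one]; simp
  have hX'sp : spectrum ℝ X' ⊆ Ioi 0 := by
    have hUu : star V ∈ Matrix.unitaryGroup (Fin n ⊕ Fin n) ℂ := Unitary.star_mem hVu
    have hφ : X' = Unitary.conjStarAlgAut ℝ _ ⟨star V, hUu⟩ (fromBlocks A 0 0 B) := by
      rw [hX', Unitary.conjStarAlgAut_apply]
      simp
    rw [hφ, AlgEquiv.spectrum_eq]
    refine (spectrum_fromBlocks_diag_subset A B).trans ?_
    exact union_subset (spectrum_subset_Ioi_of_posDef hA) (spectrum_subset_Ioi_of_posDef hB)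
  have hYsp : spectrum ℝ Y ⊆ Ioi 0 := by
    rw [hY]
    refine (spectrum_fromBlocks_diag_subset _ _).trans (union_subset
      (spectrum_subset_Ioi_of_posDef hCε) ((spectrum_smul_one_subset μ).trans ?_))
    simpa using hμpos
  -- `X' ≤ Y`
  have hYX' : (Y - X').PosSemidef := by
    rw [hY, hX'eq, fromBlocks_sub']
    have h := hμ₀ μ (le_max_left _ _)
    convert h using 2
    · rw [hC]; abel
    · simp
    · simp
  -- apply `2n`-monotonicity and compute both sides
  have hmono := hf X' Y hX'h hYh hX'sp hYsp hYX'
  have hfX' : cfc f X' = fromBlocks ((s : ℂ) • cfc f A + ((1 - s : ℝ) : ℂ) • cfc f B)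
      ((c : ℂ) • (cfc f B - cfc f A)) ((c : ℂ) • (cfc f B - cfc f A))
      (((1 - s : ℝ) : ℂ) • cfc f A + (s : ℂ) • cfc f B) := by
    have hUu : star V ∈ Matrix.unitaryGroup (Fin n ⊕ Fin n) ℂ := Unitary.star_mem hVu
    have h1 : X' = star V * fromBlocks A 0 0 B * star (star V) := by rw [star_star]
    rw [h1, cfc_unitary_conj hXh hUu, star_star, cfc_fromBlocks_diag hAh hBh, hconj]
  have hfY : cfc f Y = fromBlocks (cfc f (C + (ε : ℂ) • 1)) 0 0 (cfc f ((μ : ℂ) • 1)) := by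
    rw [hY, cfc_fromBlocks_diag hCε.1]
    unfold Matrix.IsHermitian
    rw [conjTranspose_smul, conjTranspose_one]; simp
  have hblock := hmono.submatrix Sum.inl
  rw [hfY, hfX', fromBlocks_sub'] at hblock
  have hsub : (fromBlocks (cfc f (C + (ε : ℂ) • 1) - ((s : ℂ) • cfc f A + ((1 - s : ℝ) : ℂ) • cfc f B))
      (0 - (c : ℂ) • (cfc f B - cfc f A)) (0 - (c : ℂ) • (cfc f B - cfc f A))
      (cfc f ((μ : ℂ) • 1) - (((1 - s : ℝ) : ℂ) • cfc f A + (s : ℂ) • cfc f B))).submatrix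
        Sum.inl Sum.inl =
      cfc f (C + (ε : ℂ) • 1) - ((s : ℂ) • cfc f A + ((1 - s : ℝ) : ℂ) • cfc f B) := by
    ext i j
    simp
  rw [hsub] at hblock
  rw [hC] at hblock
  exact hblock

end HansenConcavity2

section HansenConcavity3

variable {n : ℕ}

/-- Matrix monotonicity (all orders, `Fin m`-indexed) transfers to `Fin n ⊕ Fin n`-indexed
matrices by reindexing. [folklore] -/
theorem matrixMonotone_sum_of_isMatrixMonotoneOn {f : ℝ → ℝ} {Δ : Set ℝ}
    (hf : IsMatrixMonotoneOn f Δ) (X Y : Matrix (Fin n ⊕ Fin n) (Fin n ⊕ Fin n) ℂ)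
    (hX : X.IsHermitian) (hY : Y.IsHermitian) (hXs : spectrum ℝ X ⊆ Δ) (hYs : spectrum ℝ Y ⊆ Δ)
    (hXY : (Y - X).PosSemidef) : (cfc f Y - cfc f X).PosSemidef := by
  set e : Fin n ⊕ Fin n ≃ Fin (n + n) := finSumFinEquiv with he
  have hherm : ∀ {M : Matrix (Fin n ⊕ Fin n) (Fin n ⊕ Fin n) ℂ}, M.IsHermitian →
      (reindex e e M).IsHermitian := by
    intro M hM
    unfold Matrix.IsHermitian
    rw [reindex_apply, conjTranspose_submatrix, hM.eq]
  have hsp : ∀ M : Matrix (Fin n ⊕ Fin n) (Fin n ⊕ Fin n) ℂ,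
      spectrum ℝ (reindex e e M) = spectrum ℝ M := by
    intro M
    have : reindex e e M = Matrix.reindexAlgEquiv ℝ ℂ e M := rfl
    rw [this, AlgEquiv.spectrum_eq]
  have h := hf (n + n) (reindex e e X) (reindex e e Y) (hherm hX) (hherm hY)
    (by rw [hsp]; exact hXs) (by rw [hsp]; exact hYs) (by
      have : reindex e e Y - reindex e e X = reindex e e (Y - X) := by
        simp [reindex_apply, submatrix_sub]
      rw [this, reindex_apply]
      exact hXY.submatrix _)
  rw [cfc_reindex e hX, cfc_reindex e hY] at h
  have h2 := h.submatrix e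
  have : (reindex e e (cfc f Y) - reindex e e (cfc f X)).submatrix e e = cfc f Y - cfc f X := by
    simp [reindex_apply, submatrix_sub]
  rw [this] at h2
  exact h2

/-- A `1 × 1` scalar matrix `c • 1` is positive semidefinite iff `0 ≤ c`. [folklore] -/
theorem posSemidef_smul_one_fin_one_iff (c : ℝ) :
    ((c : ℂ) • (1 : Matrix (Fin 1) (Fin 1) ℂ)).PosSemidef ↔ 0 ≤ c := by
  rw [smul_one_eq_diagonal, posSemidef_diagonal_iff]
  constructor
  · intro h; exact Complex.zero_le_real.mp (h 0)
  · intro h i; exact Complex.zero_le_real.mpr h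

/-- A matrix monotone function on `(0, ∞)` is monotone there. [folklore] -/
theorem monotoneOn_of_isMatrixMonotoneOn {f : ℝ → ℝ} {Δ : Set ℝ} (hf : IsMatrixMonotoneOn f Δ) :
    MonotoneOn f Δ := by
  intro x hx y hy hxy
  have h := hf 1 ((x : ℂ) • 1) ((y : ℂ) • 1) ?_ ?_ ((spectrum_smul_one_subset x).trans
    (by simpa using hx)) ((spectrum_smul_one_subset y).trans (by simpa using hy)) ?_
  · rw [cfc_smul_one, cfc_smul_one, ← sub_smul, ← ofReal_sub, posSemidef_smul_one_fin_one_iff] at h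
    linarith
  · unfold Matrix.IsHermitian; rw [conjTranspose_smul, conjTranspose_one]; simp
  · unfold Matrix.IsHermitian; rw [conjTranspose_smul, conjTranspose_one]; simp
  · rw [← sub_smul, ← ofReal_sub, posSemidef_smul_one_fin_one_iff]; linarith

/-- **Scalar ε-concavity** of a matrix monotone function on `(0, ∞)` (Hansen 2013, inequality (1)
with `n = 1`): `s f(x) + (1 - s) f(y) ≤ f(sx + (1 - s)y + ε)`. [cite: Hansen2013, Theorem 2.1] -/
theorem convexComb_le_apply_add {f : ℝ → ℝ} (hf : IsMatrixMonotoneOn f (Ioi 0)) {x y : ℝ}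
    (hx : 0 < x) (hy : 0 < y) {s : ℝ} (hs0 : 0 ≤ s) (hs1 : s ≤ 1) {ε : ℝ} (hε : 0 < ε) :
    s * f x + (1 - s) * f y ≤ f (s * x + (1 - s) * y + ε) := by
  have hA : ((x : ℂ) • (1 : Matrix (Fin 1) (Fin 1) ℂ)).PosDef := by
    have : ((x : ℂ) • (1 : Matrix (Fin 1) (Fin 1) ℂ)) = x • (1 : Matrix (Fin 1) (Fin 1) ℂ) := rfl
    rw [this]; exact PosDef.one.smul hx
  have hB : ((y : ℂ) • (1 : Matrix (Fin 1) (Fin 1) ℂ)).PosDef := by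
    have : ((y : ℂ) • (1 : Matrix (Fin 1) (Fin 1) ℂ)) = y • (1 : Matrix (Fin 1) (Fin 1) ℂ) := rfl
    rw [this]; exact PosDef.one.smul hy
  have h := smul_cfc_add_smul_cfc_le_cfc_add (matrixMonotone_sum_of_isMatrixMonotoneOn hf)
    hA hB hs0 hs1 hε
  have e1 : (s : ℂ) • ((x : ℂ) • (1 : Matrix (Fin 1) (Fin 1) ℂ)) + ((1 - s : ℝ) : ℂ) • ((y : ℂ) • 1) +
      (ε : ℂ) • 1 = ((s * x + (1 - s) * y + ε : ℝ) : ℂ) • (1 : Matrix (Fin 1) (Fin 1) ℂ) := by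
    rw [smul_smul, smul_smul, ← add_smul, ← add_smul]
    push_cast; rfl
  rw [e1, cfc_smul_one, cfc_smul_one, cfc_smul_one, smul_smul, smul_smul, ← add_smul, ← sub_smul]
    at h
  have e2 : ((f (s * x + (1 - s) * y + ε) : ℝ) : ℂ) - ((s : ℂ) * (f x : ℂ) + ((1 - s : ℝ) : ℂ) * (f y : ℂ))
      = ((f (s * x + (1 - s) * y + ε) - (s * f x + (1 - s) * f y) : ℝ) : ℂ) := by push_cast; ring
  rw [e2, posSemidef_smul_one_fin_one_iff] at h
  linarith

/-- **Continuity** of matrix monotone functions on `(0, ∞)` (Hansen 2013, Theorem 2.1: a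
`2`-monotone function on the positive half-line is continuous). Proof: with `s = ½`,
`x = t + η`, `y = t - 3η`, `ε = η/2` the ε-inequality gives
`f(t - η/2) - f(t - 3η) ≥ ½ (f(t + η) - f(t - 3η))`; if the jump `f(t+η) - f(t-3η)` stayed `≥ κ`,
iterating `η ↦ η/6` would contradict `f ≤ f(t)` below `t`. [cite: Hansen2013, Theorem 2.1] -/
theorem continuousOn_of_isMatrixMonotoneOn_Ioi {f : ℝ → ℝ} (hf : IsMatrixMonotoneOn f (Ioi 0)) :
    ContinuousOn f (Ioi 0) := by
  have hmono := monotoneOn_of_isMatrixMonotoneOn hf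
  intro t ht
  have ht' : 0 < t := ht
  rw [ContinuousWithinAt, Metric.tendsto_nhdsWithin_nhds]
  intro κ hκ
  -- the key step: the jump over `[t - 3η, t + η]` controls the jump over `[t - 3η, t - η/2]`
  have hstep : ∀ η : ℝ, 0 < η → η < t / 3 →
      f (t + η) + f (t - 3 * η) ≤ 2 * f (t - η / 2) := by
    intro η hη hηt
    have h := convexComb_le_apply_add hf (x := t + η) (y := t - 3 * η) (by linarith) (by linarith)
      (s := 1 / 2) (by norm_num) (by norm_num) (ε := η / 2) (by linarith)
    have : 1 / 2 * (t + η) + (1 - 1 / 2) * (t - 3 * η) + η / 2 = t - η / 2 := by ring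
    rw [this] at h
    linarith
  -- find a small jump
  have hsmall : ∃ η : ℝ, 0 < η ∧ η < t / 3 ∧ f (t + η) - f (t - 3 * η) < κ := by
    by_contra hcon
    have hcon' : ∀ η : ℝ, 0 < η → η < t / 3 → κ ≤ f (t + η) - f (t - 3 * η) := by
      intro η h1 h2
      by_contra h3
      exact hcon ⟨η, h1, h2, lt_of_not_ge h3⟩
    -- iterate `η ↦ η/6`
    set η₀ : ℝ := t / 4 with hη₀
    have hη₀pos : 0 < η₀ := by positivity
    have hη₀lt : η₀ < t / 3 := by rw [hη₀]; linarith
    have hiter : ∀ k : ℕ, f (t - 3 * η₀) + k * (κ / 2) ≤ f (t - 3 * (η₀ / 6 ^ k)) := by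
      intro k
      induction k with
      | zero => simp
      | succ k ih =>
        have hηk : 0 < η₀ / 6 ^ k := by positivity
        have hηk' : η₀ / 6 ^ k < t / 3 := lt_of_le_of_lt
          (div_le_self hη₀pos.le (one_le_pow₀ (by norm_num))) hη₀lt
        have h1 := hstep _ hηk hηk'
        have h2 := hcon' _ hηk hηk'
        have h3 : t - 3 * (η₀ / 6 ^ (k + 1)) = t - η₀ / 6 ^ k / 2 := by
          rw [pow_succ]; ring
        rw [h3]
        push_cast
        linarith
    -- but `f(t - 3 η₀/6^k) ≤ f t`
    have hbdd : ∀ k : ℕ, f (t - 3 * (η₀ / 6 ^ k)) ≤ f t := by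
      intro k
      have hηk : 0 < η₀ / 6 ^ k := by positivity
      have hηk' : η₀ / 6 ^ k ≤ η₀ := div_le_self hη₀pos.le (one_le_pow₀ (by norm_num))
      apply hmono
      · show 0 < t - 3 * (η₀ / 6 ^ k)
        rw [hη₀] at hηk' ⊢; linarith
      · exact ht'
      · linarith
    obtain ⟨k, hk⟩ := exists_nat_gt ((f t - f (t - 3 * η₀)) / (κ / 2))
    have h1 := (hiter k).trans (hbdd k)
    have h2 : (f t - f (t - 3 * η₀)) / (κ / 2) * (κ / 2) = f t - f (t - 3 * η₀) := by
      field_simp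
    nlinarith [h1, hk, h2, hκ]
  obtain ⟨η, hη, hηt, hjump⟩ := hsmall
  refine ⟨η, hη, fun u hu hdist => ?_⟩
  have hu' : 0 < u := hu
  rw [Real.dist_eq] at hdist ⊢
  rw [abs_lt] at hdist ⊢
  have h1 : f (t - 3 * η) ≤ f u := hmono (show 0 < t - 3 * η by linarith) hu' (by linarith)
  have h2 : f u ≤ f (t + η) := hmono hu' (show 0 < t + η by linarith) (by linarith)
  have h3 : f (t - 3 * η) ≤ f t := hmono (show 0 < t - 3 * η by linarith) ht' (by linarith)
  have h4 : f t ≤ f (t + η) := hmono ht' (show 0 < t + η by linarith) (by linarith)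
  constructor <;> linarith

/-- **Concavity** of matrix monotone functions on `(0, ∞)` (Hansen 2013, Theorem 2.1 with
`n = 1`). [cite: Hansen2013, Theorem 2.1] -/
theorem concaveOn_of_isMatrixMonotoneOn_Ioi {f : ℝ → ℝ} (hf : IsMatrixMonotoneOn f (Ioi 0)) :
    ConcaveOn ℝ (Ioi 0) f := by
  refine ⟨convex_Ioi 0, fun x hx y hy a b ha hb hab => ?_⟩
  have hx' : 0 < x := hx
  have hy' : 0 < y := hy
  have hb' : b = 1 - a := by linarith
  subst hb'
  have hpt : 0 < a * x + (1 - a) * y := by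
    rcases ha.lt_or_eq with ha0 | ha0
    · nlinarith
    · rw [← ha0]; simpa using hy'
  have hcont := (continuousOn_of_isMatrixMonotoneOn_Ioi hf) _ hpt
  -- `f (a x + (1-a) y + ε) → f (a x + (1-a) y)` as `ε → 0⁺`
  have hlim : Tendsto (fun k : ℕ => f (a * x + (1 - a) * y + 1 / ((k : ℝ) + 1))) atTop
      (𝓝 (f (a * x + (1 - a) * y))) := by
    have h1 : Tendsto (fun k : ℕ => a * x + (1 - a) * y + 1 / ((k : ℝ) + 1)) atTop
        (𝓝[Ioi 0] (a * x + (1 - a) * y)) := by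
      refine tendsto_nhdsWithin_of_tendsto_nhds_of_eventually_within _ ?_
        (Eventually.of_forall fun k => ?_)
      · simpa using tendsto_const_nhds.add (tendsto_one_div_add_atTop_nhds_zero_nat (𝕜 := ℝ))
      · show 0 < a * x + (1 - a) * y + 1 / ((k : ℝ) + 1)
        positivity
    exact hcont.tendsto.comp h1
  have hle : ∀ k : ℕ, a * f x + (1 - a) * f y ≤ f (a * x + (1 - a) * y + 1 / ((k : ℝ) + 1)) :=
    fun k => convexComb_le_apply_add hf hx' hy' ha (by linarith) (by positivity)
  simpa [smul_eq_mul] using ge_of_tendsto hlim (Eventually.of_forall hle)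

end HansenConcavity3

section HansenConcavity4

variable {n : ℕ}

/-- Limits of functional calculi dominate a fixed matrix: if `M ≤ cfc Fₖ C` for all `k` and
`Fₖ → f` pointwise on the spectrum of `C`, then `M ≤ cfc f C`. [folklore] -/
theorem posSemidef_cfc_sub_of_tendsto {C M : Matrix (Fin n) (Fin n) ℂ} (hC : C.IsHermitian)
    (hM : M.IsHermitian) {F : ℕ → ℝ → ℝ} {f : ℝ → ℝ}
    (hlim : ∀ x ∈ spectrum ℝ C, Tendsto (fun k => F k x) atTop (𝓝 (f x)))
    (hle : ∀ k, (cfc (F k) C - M).PosSemidef) : (cfc f C - M).PosSemidef := by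
  have hherm : (cfc f C - M).IsHermitian := by
    have h1 : IsSelfAdjoint (cfc f C) := cfc_predicate f C
    exact (show (cfc f C).IsHermitian from h1).sub hM
  refine PosSemidef.of_dotProduct_mulVec_nonneg hherm fun v => ?_
  have hq : ∀ g : ℝ → ℝ, star v ⬝ᵥ ((cfc g C - M) *ᵥ v) =
      ((∑ i, g (hC.eigenvalues i) *
        Complex.normSq ((star (hC.eigenvectorUnitary : Matrix (Fin n) (Fin n) ℂ) *ᵥ v) i) : ℝ) :
          ℂ) - star v ⬝ᵥ (M *ᵥ v) := by
    intro g
    rw [sub_mulVec, dotProduct_sub, star_dotProduct_cfc_mulVec hC]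
  have hclosed : IsClosed {z : ℂ | 0 ≤ z} := by
    have : {z : ℂ | 0 ≤ z} = {z : ℂ | 0 ≤ z.re} ∩ {z : ℂ | z.im = 0} := by
      ext z
      simp only [mem_setOf_eq, mem_inter_iff, Complex.le_def, zero_re, zero_im]
      exact ⟨fun h => ⟨h.1, h.2.symm⟩, fun h => ⟨h.1, h.2.symm⟩⟩
    rw [this]
    exact (isClosed_le continuous_const continuous_re).inter (isClosed_eq continuous_im continuous_const)
  have htend : Tendsto (fun k => star v ⬝ᵥ ((cfc (F k) C - M) *ᵥ v)) atTop
      (𝓝 (star v ⬝ᵥ ((cfc f C - M) *ᵥ v))) := by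
    simp_rw [hq]
    refine Tendsto.sub ?_ tendsto_const_nhds
    refine (continuous_ofReal.tendsto _).comp ?_
    exact tendsto_finsetSum _ fun i _ =>
      (hlim _ (hC.eigenvalues_mem_spectrum_real i)).mul_const _
  exact hclosed.mem_of_tendsto htend (Eventually.of_forall fun k => (hle k).dotProduct_mulVec_nonneg v)

/-- Translating the argument of the functional calculus: `cfc f (C + ε) = cfc (f(· + ε)) C`.
[folklore] -/
theorem cfc_add_smul_one {C : Matrix (Fin n) (Fin n) ℂ} (hC : C.IsHermitian) (f : ℝ → ℝ) (ε : ℝ) :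
    cfc f (C + (ε : ℂ) • 1) = cfc (fun x => f (x + ε)) C := by
  have hC' : IsSelfAdjoint C := hC
  have h1 : cfc (fun x : ℝ => x + ε) C = C + (ε : ℂ) • 1 := by
    have h := cfc_add (a := C) (fun x : ℝ => x) (fun _ : ℝ => ε)
    rw [h, cfc_id' ℝ C, cfc_const ε C, Algebra.algebraMap_eq_smul_one]
    rfl
  rw [← h1, ← cfc_comp' f (fun x : ℝ => x + ε) C
    (((Matrix.finite_real_spectrum (A := C)).image _).continuousOn _)]

/-- **Matrix concavity of matrix monotone functions on `(0, ∞)`** (Hansen 2013, Theorem 2.1 /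
Corollary 2.2): an operator monotone `f` on the positive half-line satisfies
`s f(A) + (1 - s) f(B) ≤ f(sA + (1 - s)B)` for positive definite `A`, `B` of every order and
`0 ≤ s ≤ 1`. [cite: Hansen2013, Corollary 2.2] -/
theorem smul_cfc_add_smul_cfc_le_cfc {f : ℝ → ℝ} (hf : IsMatrixMonotoneOn f (Ioi 0))
    {A B : Matrix (Fin n) (Fin n) ℂ} (hA : A.PosDef) (hB : B.PosDef) {s : ℝ} (hs0 : 0 ≤ s)
    (hs1 : s ≤ 1) :
    (cfc f ((s : ℂ) • A + ((1 - s : ℝ) : ℂ) • B) -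
      ((s : ℂ) • cfc f A + ((1 - s : ℝ) : ℂ) • cfc f B)).PosSemidef := by
  set C : Matrix (Fin n) (Fin n) ℂ := (s : ℂ) • A + ((1 - s : ℝ) : ℂ) • B with hC
  have hAh : A.IsHermitian := hA.1
  have hBh : B.IsHermitian := hB.1
  have hCh : C.IsHermitian := by
    unfold Matrix.IsHermitian
    rw [hC, conjTranspose_add, conjTranspose_smul, conjTranspose_smul, hAh.eq, hBh.eq]
    simp
  have hCpsd : C.PosSemidef := by
    have h1 : ((s : ℂ) • A).PosSemidef := by
      have : ((s : ℂ) • A) = s • A := rfl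
      rw [this]; exact hA.posSemidef.smul hs0
    have h2 : (((1 - s : ℝ) : ℂ) • B).PosSemidef := by
      have : (((1 - s : ℝ) : ℂ) • B) = (1 - s) • B := rfl
      rw [this]; exact hB.posSemidef.smul (by linarith)
    exact h1.add h2
  have hCsp : spectrum ℝ C ⊆ Ici 0 := by
    rw [hCpsd.1.spectrum_real_eq_range_eigenvalues]
    rintro _ ⟨i, rfl⟩
    exact hCpsd.eigenvalues_nonneg i
  have hMh : ((s : ℂ) • cfc f A + ((1 - s : ℝ) : ℂ) • cfc f B).IsHermitian := by
    have h1 : (cfc f A).IsHermitian := (cfc_predicate f A : IsSelfAdjoint _)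
    have h2 : (cfc f B).IsHermitian := (cfc_predicate f B : IsSelfAdjoint _)
    unfold Matrix.IsHermitian
    rw [conjTranspose_add, conjTranspose_smul, conjTranspose_smul, h1.eq, h2.eq]
    simp
  refine posSemidef_cfc_sub_of_tendsto hCh hMh (F := fun k x => f (x + 1 / ((k : ℝ) + 1)))
    (fun x hx => ?_) (fun k => ?_)
  · -- points of the spectrum of `C` are positive, and `f` is continuous there
    have hCpd : C.PosDef := by
      rcases hs0.lt_or_eq with hs | hs
      · have h1 : ((s : ℂ) • A).PosDef := by
          have : ((s : ℂ) • A) = s • A := rfl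
          rw [this]; exact hA.smul hs
        have h2 : (((1 - s : ℝ) : ℂ) • B).PosSemidef := by
          have : (((1 - s : ℝ) : ℂ) • B) = (1 - s) • B := rfl
          rw [this]; exact hB.posSemidef.smul (by linarith)
        exact h1.add_posSemidef h2
      · rw [hC, ← hs]; simpa using hB
    have hx0 : 0 < x := spectrum_subset_Ioi_of_posDef hCpd hx
    have hcont := (continuousOn_of_isMatrixMonotoneOn_Ioi hf) x hx0
    have h1 : Tendsto (fun k : ℕ => x + 1 / ((k : ℝ) + 1)) atTop (𝓝[Ioi 0] x) := by
      refine tendsto_nhdsWithin_of_tendsto_nhds_of_eventually_within _ ?_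
        (Eventually.of_forall fun k => ?_)
      · simpa using tendsto_const_nhds.add (tendsto_one_div_add_atTop_nhds_zero_nat (𝕜 := ℝ))
      · show 0 < x + 1 / ((k : ℝ) + 1)
        positivity
    exact hcont.tendsto.comp h1
  · have h := smul_cfc_add_smul_cfc_le_cfc_add (matrixMonotone_sum_of_isMatrixMonotoneOn hf)
      hA hB hs0 hs1 (ε := 1 / ((k : ℝ) + 1)) (by positivity)
    rw [cfc_add_smul_one hCh] at h
    exact h

end HansenConcavity4

end Literature.Analysis.Complex
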